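import Mathlib

/-!
# `NewtonUnitEquationsNewtonTauWeakExposedChordUnique` — a nonzero difference vector occurs at most once among
# strictly positively exposed points

Line `binomial-normal-form` of crux `NewtonTauWeak` (stmt-ValiantsHypothesis-5904), lead c7, stub P8
(`stub_exposedChordUnique`, the registered text verbatim).

A point `m` of a planar cloud `S ⊆ ℕ²` is *strictly positively exposed* when it is the strict minimiser over `S`
of some functional `w₀ x₀ + w₁ x₁` with `w₀, w₁ > 0`.  P8 is the rigidity fact behind the datum-counting bound on
exposed configurations: if `p ≠ p'` and `p, p', q, q'` are all exposed with `p - p' = q - q'`, then `p = q`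
(two chords of a strictly convex chain with the same vector coincide).

## Proof

Everything is elementary real arithmetic on the coordinates.
* `secant_real` / `secant_pts`: if `m` is exposed and `l, r ∈ S` have `l₀ < m₀ < r₀`, then
  `slope(l, m) < slope(m, r)` in cross-multiplied form (only `w₁ > 0` is used).
* `eq_of_fst_eq`: two exposed points with the same first coordinate are equal.
* `main_false`: for exposed `a, b'` and `a', b ∈ S` with `b - b' = a - a'`, `a'₀ < a₀` and `a'₀ < b'₀` one gets a
  contradiction, by two applications of the secant inequality in each of the three cases `a₀ < b'₀`, `a₀ = b'₀`,
  `b'₀ < a₀` (the two inequalities are `X < Y` and `Y < X`).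
* The theorem: the common difference vector `v = p - p'` has `v₀ ≠ 0` (else `p = p'` by `eq_of_fst_eq`); the four
  sign/order cases (`v₀ > 0` or `< 0`, and the order of the two left endpoints) are dispatched to `main_false` by
  permuting the points, the tie cases to `eq_of_fst_eq`.

Helpers live in the sub-namespace `ExposedChordUniqueAux`; Mathlib only; everything is [folklore].
-/

-- justification: the namespace mandated for this Theorems file repeats the component `ValiantsHypothesis`
set_option linter.dupNamespace false -- single-conjunct summit layout `ValiantsHypothesis.ValiantsHypothesis`

namespace Summit.ValiantsHypothesis.ValiantsHypothesis.Theorems.NewtonUnitEquationsNewtonTauWeak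

namespace ExposedChordUniqueAux

/-- The secant inequality in pure real form: if `(m₀, m₁)` strictly minimises `w₀ x₀ + w₁ x₁` against `(l₀, l₁)`
and `(r₀, r₁)`, with `w₁ > 0` and `l₀ < m₀ < r₀`, then `slope(l, m) < slope(m, r)` (cross-multiplied). [folklore] -/
theorem secant_real {w0 w1 m0 m1 l0 l1 r0 r1 : ℝ} (hw1 : 0 < w1)
    (hl : w0 * m0 + w1 * m1 < w0 * l0 + w1 * l1) (hr : w0 * m0 + w1 * m1 < w0 * r0 + w1 * r1)
    (hlm : l0 < m0) (hmr : m0 < r0) :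
    (m1 - l1) * (r0 - m0) < (r1 - m1) * (m0 - l0) := by
  have p1 := mul_lt_mul_of_pos_right hl (sub_pos.mpr hmr)
  have p2 := mul_lt_mul_of_pos_right hr (sub_pos.mpr hlm)
  have key : w1 * ((m1 - l1) * (r0 - m0)) < w1 * ((r1 - m1) * (m0 - l0)) := by linarith
  exact lt_of_mul_lt_mul_left key hw1.le

/-- The secant inequality for an exposed point `m` of `S` between two points `l, r ∈ S` (`l₀ < m₀ < r₀`):
`(m₁ - l₁)(r₀ - m₀) < (r₁ - m₁)(m₀ - l₀)`. [folklore] -/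
theorem secant_pts (S : Set (Fin 2 →₀ ℕ)) (m l r : Fin 2 →₀ ℕ) (hl : l ∈ S) (hr : r ∈ S)
    (hm : ∃ w : Fin 2 → ℝ, 0 < w 0 ∧ 0 < w 1 ∧ ∀ r ∈ S, r ≠ m →
      w 0 * ((m 0 : ℕ) : ℝ) + w 1 * ((m 1 : ℕ) : ℝ) < w 0 * ((r 0 : ℕ) : ℝ) + w 1 * ((r 1 : ℕ) : ℝ))
    (hlm : ((l 0 : ℕ) : ℝ) < ((m 0 : ℕ) : ℝ)) (hmr : ((m 0 : ℕ) : ℝ) < ((r 0 : ℕ) : ℝ)) :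
    (((m 1 : ℕ) : ℝ) - ((l 1 : ℕ) : ℝ)) * (((r 0 : ℕ) : ℝ) - ((m 0 : ℕ) : ℝ)) <
      (((r 1 : ℕ) : ℝ) - ((m 1 : ℕ) : ℝ)) * (((m 0 : ℕ) : ℝ) - ((l 0 : ℕ) : ℝ)) := by
  obtain ⟨w, -, hw1, hw⟩ := hm
  have hl' := hw l hl (by rintro rfl; exact lt_irrefl _ hlm)
  have hr' := hw r hr (by rintro rfl; exact lt_irrefl _ hmr)
  exact secant_real hw1 hl' hr' hlm hmr

/-- Two exposed points of `S` with the same first coordinate are equal. [folklore] -/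
theorem eq_of_fst_eq (S : Set (Fin 2 →₀ ℕ)) (m m' : Fin 2 →₀ ℕ) (hm : m ∈ S) (hm' : m' ∈ S)
    (em : ∃ w : Fin 2 → ℝ, 0 < w 0 ∧ 0 < w 1 ∧ ∀ r ∈ S, r ≠ m →
      w 0 * ((m 0 : ℕ) : ℝ) + w 1 * ((m 1 : ℕ) : ℝ) < w 0 * ((r 0 : ℕ) : ℝ) + w 1 * ((r 1 : ℕ) : ℝ))
    (em' : ∃ w : Fin 2 → ℝ, 0 < w 0 ∧ 0 < w 1 ∧ ∀ r ∈ S, r ≠ m' →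
      w 0 * ((m' 0 : ℕ) : ℝ) + w 1 * ((m' 1 : ℕ) : ℝ) < w 0 * ((r 0 : ℕ) : ℝ) + w 1 * ((r 1 : ℕ) : ℝ))
    (h : ((m 0 : ℕ) : ℝ) = ((m' 0 : ℕ) : ℝ)) : m = m' := by
  by_contra hne
  obtain ⟨w, -, hw1, hw⟩ := em
  obtain ⟨w', -, hw1', hw'⟩ := em'
  have h1 := hw m' hm' (Ne.symm hne)
  have h2 := hw' m hm hne
  rw [h] at h1 h2
  have k1 : ((m 1 : ℕ) : ℝ) < ((m' 1 : ℕ) : ℝ) := lt_of_mul_lt_mul_left (by linarith) hw1.le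
  have k2 : ((m' 1 : ℕ) : ℝ) < ((m 1 : ℕ) : ℝ) := lt_of_mul_lt_mul_left (by linarith) hw1'.le
  linarith

/-- The core contradiction: `a` and `b'` exposed, `a', b ∈ S`, `b - b' = a - a'` (coordinatewise, over `ℝ`),
`a'₀ < a₀` and `a'₀ < b'₀` is impossible (two secant inequalities `X < Y`, `Y < X` in each of the cases
`a₀ < b'₀`, `a₀ = b'₀`, `b'₀ < a₀`). [folklore] -/
theorem main_false (S : Set (Fin 2 →₀ ℕ)) (a a' b b' : Fin 2 →₀ ℕ)
    (ha : a ∈ S) (ha' : a' ∈ S) (hb : b ∈ S) (hb' : b' ∈ S)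
    (ea : ∃ w : Fin 2 → ℝ, 0 < w 0 ∧ 0 < w 1 ∧ ∀ r ∈ S, r ≠ a →
      w 0 * ((a 0 : ℕ) : ℝ) + w 1 * ((a 1 : ℕ) : ℝ) < w 0 * ((r 0 : ℕ) : ℝ) + w 1 * ((r 1 : ℕ) : ℝ))
    (eb' : ∃ w : Fin 2 → ℝ, 0 < w 0 ∧ 0 < w 1 ∧ ∀ r ∈ S, r ≠ b' →
      w 0 * ((b' 0 : ℕ) : ℝ) + w 1 * ((b' 1 : ℕ) : ℝ) < w 0 * ((r 0 : ℕ) : ℝ) + w 1 * ((r 1 : ℕ) : ℝ))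
    (hlt : ((a' 0 : ℕ) : ℝ) < ((a 0 : ℕ) : ℝ)) (hlt' : ((a' 0 : ℕ) : ℝ) < ((b' 0 : ℕ) : ℝ))
    (h0 : ((b 0 : ℕ) : ℝ) = ((b' 0 : ℕ) : ℝ) + (((a 0 : ℕ) : ℝ) - ((a' 0 : ℕ) : ℝ)))
    (h1 : ((b 1 : ℕ) : ℝ) = ((b' 1 : ℕ) : ℝ) + (((a 1 : ℕ) : ℝ) - ((a' 1 : ℕ) : ℝ))) : False := by
  have hbb : ((b' 0 : ℕ) : ℝ) < ((b 0 : ℕ) : ℝ) := by linarith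
  have hab : ((a 0 : ℕ) : ℝ) < ((b 0 : ℕ) : ℝ) := by linarith
  rcases lt_trichotomy ((a 0 : ℕ) : ℝ) ((b' 0 : ℕ) : ℝ) with h | h | h
  · have s1 := secant_pts S a a' b' ha' hb' ea hlt h
    have s2 := secant_pts S b' a b ha hb eb' h hbb
    rw [h0, h1] at s2
    linarith
  · have s1 := secant_pts S a a' b ha' hb ea hlt hab
    have s2 := secant_pts S b' a' b ha' hb eb' hlt' hbb
    rw [h0, h1, ← h] at s1 s2
    linarith
  · have s1 := secant_pts S b' a' a ha' ha eb' hlt' h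
    have s2 := secant_pts S a b' b hb' hb ea h hab
    rw [h0, h1] at s2
    linarith

end ExposedChordUniqueAux

/-- STUB P8 — **a nonzero difference vector occurs at most once among strictly positively exposed points.**
If `p, p', q, q' ∈ S ⊆ ℕ²` are each the strict minimiser over `S` of a functional `w₀ x₀ + w₁ x₁` with
`w₀, w₁ > 0`, `p ≠ p'`, and `p - p' = q - q'` coordinatewise (over `ℤ`), then `p = q`.  Proof: the exposed points
form a strictly convex chain with pairwise distinct first coordinates (`eq_of_fst_eq`), along which secant slopes
strictly increase (`secant_pts`), so two distinct chords never have the same vector (`main_false`, applied to a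
permutation of the four points according to the sign of `p₀ - p'₀` and the order of the left endpoints).
[folklore] -/
theorem stub_exposedChordUnique (S : Set (Fin 2 →₀ ℕ)) (p p' q q' : Fin 2 →₀ ℕ)
    (hp : p ∈ S) (hp' : p' ∈ S) (hq : q ∈ S) (hq' : q' ∈ S)
    (hexp : ∀ m : Fin 2 →₀ ℕ, (m = p ∨ m = p' ∨ m = q ∨ m = q') →
      ∃ w : Fin 2 → ℝ, 0 < w 0 ∧ 0 < w 1 ∧ ∀ r ∈ S, r ≠ m →
        w 0 * ((m 0 : ℕ) : ℝ) + w 1 * ((m 1 : ℕ) : ℝ) < w 0 * ((r 0 : ℕ) : ℝ) + w 1 * ((r 1 : ℕ) : ℝ))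
    (hne : p ≠ p')
    (h0 : ((p 0 : ℕ) : ℤ) - ((p' 0 : ℕ) : ℤ) = ((q 0 : ℕ) : ℤ) - ((q' 0 : ℕ) : ℤ))
    (h1 : ((p 1 : ℕ) : ℤ) - ((p' 1 : ℕ) : ℤ) = ((q 1 : ℕ) : ℤ) - ((q' 1 : ℕ) : ℤ)) :
    p = q := by
  have xp := hexp p (Or.inl rfl)
  have xp' := hexp p' (Or.inr (Or.inl rfl))
  have xq := hexp q (Or.inr (Or.inr (Or.inl rfl)))
  have xq' := hexp q' (Or.inr (Or.inr (Or.inr rfl)))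
  have h0r : ((p 0 : ℕ) : ℝ) - ((p' 0 : ℕ) : ℝ) = ((q 0 : ℕ) : ℝ) - ((q' 0 : ℕ) : ℝ) := by
    have h := congrArg (Int.cast : ℤ → ℝ) h0
    push_cast at h
    linarith
  have h1r : ((p 1 : ℕ) : ℝ) - ((p' 1 : ℕ) : ℝ) = ((q 1 : ℕ) : ℝ) - ((q' 1 : ℕ) : ℝ) := by
    have h := congrArg (Int.cast : ℤ → ℝ) h1
    push_cast at h
    linarith
  rcases lt_trichotomy ((p' 0 : ℕ) : ℝ) ((p 0 : ℕ) : ℝ) with hlt | heq | hgt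
  · -- `v₀ > 0`: the pairs `(p', p)` and `(q', q)` point to the right
    rcases lt_trichotomy ((p' 0 : ℕ) : ℝ) ((q' 0 : ℕ) : ℝ) with h | h | h
    · exact (ExposedChordUniqueAux.main_false S p p' q q' hp hp' hq hq' xp xq' hlt h
        (by linarith) (by linarith)).elim
    · exact ExposedChordUniqueAux.eq_of_fst_eq S p q hp hq xp xq (by linarith)
    · exact (ExposedChordUniqueAux.main_false S q q' p p' hq hq' hp hp' xq xp' (by linarith) h
        (by linarith) (by linarith)).elim
  · -- `v₀ = 0`: then `p = p'`, excluded
    exact absurd (ExposedChordUniqueAux.eq_of_fst_eq S p p' hp hp' xp xp' heq.symm) hne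
  · -- `v₀ < 0`: use the reversed pairs `(p, p')` and `(q, q')`
    rcases lt_trichotomy ((p 0 : ℕ) : ℝ) ((q 0 : ℕ) : ℝ) with h | h | h
    · exact (ExposedChordUniqueAux.main_false S p' p q' q hp' hp hq' hq xp' xq hgt h
        (by linarith) (by linarith)).elim
    · exact ExposedChordUniqueAux.eq_of_fst_eq S p q hp hq xp xq h
    · exact (ExposedChordUniqueAux.main_false S q' q p' p hq' hq hp' hp xq' xp (by linarith) h
        (by linarith) (by linarith)).elim

end Summit.ValiantsHypothesis.ValiantsHypothesis.Theorems.NewtonUnitEquationsNewtonTauWeak
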